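import Summits.QuantumFields.QCD.Theorems.QuarksAsStableActionStableActionBridgeWilsonTransferForm
import Literature.MathematicalPhysics.QuantumLattice.WilsonDiracAP

/-!
# Transfer-matrix form of the ANTIPERIODIC Wilson fermion determinant
(helper for crux stmt-QuantumFields-9737 `QuarksAsStableAction.StableActionBridge`, line `Sketch`;
stub `apDet_transfer_form`)

The route's fermion determinant is `apDet U m = fermionDet (wilsonDiracAP U m)`, the determinant of
the `r = 1` Wilson–Dirac operator of the antiperiodic `U(N)` lift `apLift U` of an `SU(N)` field `U`
on `(ℤ/L)⁴` (`wilsonDiracAP U m = wilsonDirac (unitaryFundamentalRep (Fin N) ℂ) (apLift U) m 1`).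
Lüscher's transfer-matrix form of the time-PERIODIC Wilson determinant
(`wilson_det_transfer_form`, p120730), instantiated at `ρ :=` the defining representation of `U(N)`
and the field `apLift U`, reads `det D_W[apLift U] = (∏_t det E_t) · det (1 − ∏_{i<L} M_i W_i)` with
positive one-step matrices `M_i` and the temporal transporters `W_i = (apLift U)((i,·),0) ⊗ 1_spin`.
The antiperiodic lift flips exactly the temporal links leaving the last slice `i = L − 1`
(`coe_apLift_apply`): `W_i = Ŵ_i` for `i < L − 1` and `W_{L−1} = −Ŵ_{L−1}`, where
`Ŵ_i = U((i,·),0) ⊗ 1_spin` are the untwisted transporters.  Hence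
`∏_{i<L} M_i W_i = −∏_{i<L} M_i Ŵ_i` and
`apDet U m = (∏_t det E_t) · det (1 + ∏_{i<L} M_i Ŵ_i)`: the time seam of the antiperiodic
boundary condition is the sign turning Lüscher's `det (1 − ·)` into the Fock TRACE `det (1 + ·)`.
[cite: Luscher1977, pp. 283–292] [cite: MontvayMunster1994, §4.2.4 (4.112)–(4.114)]
Pure theorem file (no definitions).
-/

noncomputable section

namespace Summit.QuantumFields.QCD.Cruxes.StableActionBridge.Sketch

open scoped ComplexOrder Kronecker
open Literature.MathematicalPhysics.QuantumFieldTheory Literature.MathematicalPhysics.QuantumLattice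
open Literature.Probability.LatticeModels (TorusSite)

namespace APDetTransferForm

/-- In `ZMod L` with `L = k + 1`, the residue of `k` is `−1`. -/
theorem natCast_eq_neg_one {L k : ℕ} (hL : k + 1 = L) : ((k : ℕ) : ZMod L) = -1 := by
  have h : ((k : ℕ) : ZMod L) + 1 = 0 := by
    rw [← Nat.cast_add_one, hL, ZMod.natCast_self]
  exact eq_neg_of_add_eq_zero_left h

/-- In `ZMod L` with `L = k + 1`, no `i < k` has residue `−1` (else `L ∣ i + 1 < L`). -/
theorem natCast_ne_neg_one {L k i : ℕ} (hL : k + 1 = L) (hi : i < k) : ((i : ℕ) : ZMod L) ≠ -1 := by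
  intro h
  have h1 : ((i + 1 : ℕ) : ZMod L) = 0 := by
    rw [Nat.cast_add_one, h, neg_add_cancel]
  rw [ZMod.natCast_eq_zero_iff] at h1
  have h2 := Nat.le_of_dvd (Nat.succ_pos i) h1
  omega

/-- **Sign extraction from the last factor.** If `f i = g i` for `i < k` and `f k = −g k`, then
`∏_{i<k+1} f i = −∏_{i<k+1} g i` (ordered list products in a ring). -/
theorem prod_map_range_eq_neg {R : Type*} [Ring R] {L k : ℕ} (hL : k + 1 = L) (f g : ℕ → R)
    (hlt : ∀ i < k, f i = g i) (hk : f k = -g k) :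
    ((List.range L).map f).prod = -((List.range L).map g).prod := by
  subst hL
  have hfg : (List.range k).map f = (List.range k).map g :=
    List.map_congr_left fun i hi => hlt i (List.mem_range.1 hi)
  rw [List.prod_range_succ, List.prod_range_succ, hk, mul_neg, hfg]

end APDetTransferForm

-- The registered signature binds the lifted transporter `W` (the `W` of `wilson_det_transfer_form`) by a
-- `let` that its conclusion does not mention (only `Wt` appears), so `linter.unusedVariables` reports that
-- binder for every proof; the linter is switched off for this one declaration only.
set_option linter.unusedVariables false in
/-- **Transfer-matrix form of the antiperiodic Wilson fermion determinant** (stub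
`apDet_transfer_form` of line `Sketch`): for every `SU(N)` field `U` on `(ℤ/L)⁴` and `m > −1`,
`fermionDet (wilsonDiracAP U m) = (∏_t det E_t) · det (1 + ∏_{i<L} M_i Ŵ_i)` with Lüscher's positive
definite one-step matrices `M_i` (of the lifted field `apLift U`) and the UNtwisted temporal
transporters `Ŵ_i = U((i,·),0) ⊗ 1_spin`; the time-seam sign of `apLift` turns `det (1 − ·)` of the
periodic formula `wilson_det_transfer_form` into `det (1 + ·)`.
[cite: Luscher1977, pp. 283–292] [cite: MontvayMunster1994, §4.2.4 (4.112)–(4.114)] -/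
theorem apDet_transfer_form :
    ∀ (N L : ℕ) [NeZero L] (U : GaugeConfig 4 L (Matrix.specialUnitaryGroup (Fin N) ℂ)) (m : ℝ), -1 < m →
      let Pp : Matrix (TorusSite 3 L × Fin N × Fin 4) (TorusSite 3 L × Fin N × Fin 4) ℂ := Matrix.of fun a b =>
        if a.1 = b.1 ∧ a.2.1 = b.2.1 then ((1 / 2 : ℂ) • (1 + euclideanGamma 0)) a.2.2 b.2.2 else 0;
      let Pm : Matrix (TorusSite 3 L × Fin N × Fin 4) (TorusSite 3 L × Fin N × Fin 4) ℂ := Matrix.of fun a b =>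
        if a.1 = b.1 ∧ a.2.1 = b.2.1 then ((1 / 2 : ℂ) • (1 - euclideanGamma 0)) a.2.2 b.2.2 else 0;
      let W : ZMod L → Matrix (TorusSite 3 L × Fin N × Fin 4) (TorusSite 3 L × Fin N × Fin 4) ℂ := fun t =>
        Matrix.of fun a b => if a.1 = b.1 ∧ a.2.2 = b.2.2 then
          unitaryFundamentalRep (Fin N) ℂ (apLift U ((Fin.cons t a.1 : TorusSite 4 L), 0)) a.2.1 b.2.1 else 0;
      let W' : ZMod L → Matrix (TorusSite 3 L × Fin N × Fin 4) (TorusSite 3 L × Fin N × Fin 4) ℂ := fun t =>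
        Matrix.of fun a b => if a.1 = b.1 ∧ a.2.2 = b.2.2 then
          unitaryFundamentalRep (Fin N) ℂ (apLift U ((Fin.cons t a.1 : TorusSite 4 L), 0))⁻¹ a.2.1 b.2.1 else 0;
      let A : ZMod L → Matrix (TorusSite 3 L × Fin N × Fin 4) (TorusSite 3 L × Fin N × Fin 4) ℂ := fun t =>
        Matrix.of fun a b =>
          (if a = b then ((m + 4 * 1 : ℝ) : ℂ) else 0) -
            (1 / 2 : ℂ) * ∑ j : Fin 3,
              ((if b.1 = Literature.MathematicalPhysics.QuantumFieldTheory.Site.shift a.1 j then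
                  (((1 : ℝ) : ℂ) • (1 : Matrix (Fin 4) (Fin 4) ℂ) - euclideanGamma j.succ) a.2.2 b.2.2 *
                    unitaryFundamentalRep (Fin N) ℂ (apLift U ((Fin.cons t a.1 : TorusSite 4 L), j.succ)) a.2.1 b.2.1
                else 0) +
                (if a.1 = Literature.MathematicalPhysics.QuantumFieldTheory.Site.shift b.1 j then
                  (((1 : ℝ) : ℂ) • (1 : Matrix (Fin 4) (Fin 4) ℂ) + euclideanGamma j.succ) a.2.2 b.2.2 *
                    unitaryFundamentalRep (Fin N) ℂ (apLift U ((Fin.cons t b.1 : TorusSite 4 L), j.succ))⁻¹ a.2.1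
                      b.2.1
                else 0));
      let B : ZMod L → Matrix (TorusSite 3 L × Fin N) (TorusSite 3 L × Fin N) ℂ := fun t => Matrix.of fun a b =>
          (if a = b then ((m + 4 : ℝ) : ℂ) else 0) -
            (1 / 2 : ℂ) * ∑ j : Fin 3,
              ((if b.1 = Literature.MathematicalPhysics.QuantumFieldTheory.Site.shift a.1 j then
                  unitaryFundamentalRep (Fin N) ℂ (apLift U ((Fin.cons t a.1 : TorusSite 4 L), j.succ)) a.2 b.2
                else 0) +
                (if a.1 = Literature.MathematicalPhysics.QuantumFieldTheory.Site.shift b.1 j then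
                  unitaryFundamentalRep (Fin N) ℂ (apLift U ((Fin.cons t b.1 : TorusSite 4 L), j.succ))⁻¹ a.2 b.2
                else 0));
      let Bh : ZMod L → Matrix (TorusSite 3 L × Fin N × Fin 4) (TorusSite 3 L × Fin N × Fin 4) ℂ := fun t =>
        Matrix.of fun a b => if a.2.2 = b.2.2 then B t (a.1, a.2.1) (b.1, b.2.1) else 0;
      let M : ZMod L → Matrix (TorusSite 3 L × Fin N × Fin 4) (TorusSite 3 L × Fin N × Fin 4) ℂ := fun t =>
        (1 + Pp * (A t - Bh t) * Pm) * (Bh t * Pp + (Bh t)⁻¹ * Pm) * (1 - Pm * (A t - Bh t) * Pp);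
      let Wt : ZMod L → Matrix (TorusSite 3 L × Fin N × Fin 4) (TorusSite 3 L × Fin N × Fin 4) ℂ := fun t =>
        Matrix.of fun a b => if a.1 = b.1 ∧ a.2.2 = b.2.2 then
          (U ((Fin.cons t a.1 : TorusSite 4 L), 0) : Matrix (Fin N) (Fin N) ℂ) a.2.1 b.2.1 else 0;
      fermionDet (wilsonDiracAP U m) =
          (∏ t : ZMod L, (A t * Pm - Pp * W' (t - 1)).det) *
            (1 + ((List.range L).map fun i : ℕ => M (i : ZMod L) * Wt (i : ZMod L)).prod).det ∧
        ∀ t : ZMod L, (M t).PosDef := by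
  intro N L _ U m hm Pp Pm W W' A B Bh M Wt
  -- (1) Lüscher's periodic formula for the lifted `U(N)` field `apLift U`
  have h : (wilsonDirac (unitaryFundamentalRep (Fin N) ℂ) (apLift U) m 1).det =
      (∏ t : ZMod L, (A t * Pm - Pp * W' (t - 1)).det) *
        (1 - ((List.range L).map fun i : ℕ => M (i : ZMod L) * W (i : ZMod L)).prod).det ∧
      ∀ t : ZMod L, (M t).PosDef :=
    wilson_det_transfer_form N L (Matrix.unitaryGroup (Fin N) ℂ) (unitaryFundamentalRep (Fin N) ℂ)
      unitaryFundamentalRep_mem_unitaryGroup (apLift U) m hm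
  refine ⟨?_, h.2⟩
  -- (2) the lifted transporters: untwisted off the seam, flipped on the seam `t = -1`
  have hW1 : ∀ t : ZMod L, t ≠ -1 → W t = Wt t := fun t ht => by
    ext a b
    simp only [W, Wt, Matrix.of_apply, unitaryFundamentalRep_apply, coe_apLift_apply, Fin.cons_zero,
      if_neg ht]
  have hW2 : ∀ t : ZMod L, t = -1 → W t = -Wt t := fun t ht => by
    ext a b
    simp only [W, Wt, Matrix.of_apply, Matrix.neg_apply, unitaryFundamentalRep_apply, coe_apLift_apply,
      Fin.cons_zero, if_pos ht]
    split_ifs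
    · rfl
    · rw [neg_zero]
  -- (3) the seam sign leaves the ordered product as an overall `-1`
  have hL : L - 1 + 1 = L := Nat.sub_one_add_one_eq_of_pos (NeZero.pos L)
  have hprod : ((List.range L).map fun i : ℕ => M (i : ZMod L) * W (i : ZMod L)).prod =
      -((List.range L).map fun i : ℕ => M (i : ZMod L) * Wt (i : ZMod L)).prod := by
    refine APDetTransferForm.prod_map_range_eq_neg hL _ _ (fun i hi => ?_) ?_
    · show M (i : ZMod L) * W (i : ZMod L) = M (i : ZMod L) * Wt (i : ZMod L)
      rw [hW1 _ (APDetTransferForm.natCast_ne_neg_one hL hi)]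
    · show M ((L - 1 : ℕ) : ZMod L) * W ((L - 1 : ℕ) : ZMod L) =
        -(M ((L - 1 : ℕ) : ZMod L) * Wt ((L - 1 : ℕ) : ZMod L))
      rw [hW2 _ (APDetTransferForm.natCast_eq_neg_one hL), mul_neg]
  rw [hprod, sub_neg_eq_add] at h
  exact h.1

end Summit.QuantumFields.QCD.Cruxes.StableActionBridge.Sketch

end
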